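import Mathlib
import Summits.ResolutionOfSingularities.ResolutionOfSingularities.Theorems.WeightedInvariantLocalWeightedDropTOT2CurveConflictPointMove
import Summits.ResolutionOfSingularities.ResolutionOfSingularities.Theorems.WeightedInvariantLocalWeightedDropNCPolyBridgeExit

/-!
# `LocalWeightedDrop`, NC count game — TOT2-LINE piece S-CRV (v1.2 (D)/(G3)): the conflict step with PREPARED successors, and the regime reading of
# point successors

[OURS · L1 W4.3 · chain w43, engine crux `LocalWeightedDrop` stmt-ResolutionOfSingularities-8899; piece S-CRV = res-type-088; `--supports 8899 --as helper`,
counted 0; definition-free; nothing here is a statement of any manuscript; AI-written (gate-accepted = sorry-free with standard axioms, not refereed).]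

For the inner composition (G3) at a `NCPoly.Conflict` state:
* **`conflict_pointMove_prep`** — `conflict_pointMove` with the `u₁`-chart successors RE-PREPARED for free (`NCPoly.Represents.shift`,
  `PolyDescent.blowOneT_shift`, as in `NCPoly.pointMove_succ_of_represents`): every successor is unit × monomial, or represents
  `blowOneT d (prep d (shearT (C c) A))` with boundary `{u₁} ∪ {u₂ : u₂ ∈ N, c = 0}` — carrying, at `c = λ`, a permissible graph branch with datum
  `h₁` (F3 with the preparing re-centring) —, or represents `blowTwoT d A` with boundary `{u₂} ∪ {u₁ : u₁ ∈ N}`;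
* `wellPrepared_pointSucc_prep`, `wellPrepared_pointSucc_two`, **`inPoly_or_exit_of_wellPrepared`** — these successor labels are well-prepared, so each
  is in the regime (`PolyDescent.InPoly`) or an exit (not a position, or empty Newton set): the reading (G2) needs at conflict states, where
  `PolyDescent.exit_cases` (about `succT`-successors) does not apply.
-/

set_option linter.dupNamespace false -- mandated namespace of this single-conjunct summit

noncomputable section

namespace Summit.ResolutionOfSingularities.ResolutionOfSingularities.Theorems

namespace TOT2Curve

open MvPowerSeries PolyDescent MonicDescent WildMonic Literature.AlgebraicGeometry.Resolution TameFourTupleDrop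

variable {k : Type} [Field k] {d : ℕ}

/-! ## Well-preparedness of the point successors; regime or exit -/

/-- The prepared translated `u₁`-chart successor of ANY position is well-prepared. -/
theorem wellPrepared_pointSucc_prep (hd : 0 < d) {A : Fin d → MvPowerSeries (Fin 2) k} (hpos : IsPosT d A) (c : k) :
    WellPrepared d (blowOneT d (prep d (shearT (C c) A))) := by
  have hposY : IsPosT d (shearT (C c) A) := isPosT_shearT _ hpos
  obtain ⟨-, hposB, hWPB, -⟩ := isPrepRecentring_prepPsi (stub_polyPrep k d hd _ hposY)
  exact wellPrepared_blowOneT _ hposB hWPB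

/-- The `u₂`-chart successor of a well-prepared position is well-prepared. -/
theorem wellPrepared_pointSucc_two {A : Fin d → MvPowerSeries (Fin 2) k} (hpos : IsPosT d A) (hWP : WellPrepared d A) :
    WellPrepared d (blowTwoT d A) :=
  wellPrepared_blowTwoT A hpos hWP

/-- A well-prepared label is in the regime or an exit (not a position, or empty Newton set). -/
theorem inPoly_or_exit_of_wellPrepared {A : Fin d → MvPowerSeries (Fin 2) k} (hWP : WellPrepared d A) :
    InPoly d A ∨ ¬ IsPosT d A ∨ ¬ (newtonSet A).Nonempty := by
  by_cases h1 : IsPosT d A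
  · by_cases h2 : (newtonSet A).Nonempty
    · exact Or.inl ⟨hWP, h1, h2⟩
    · exact Or.inr (Or.inr h2)
  · exact Or.inr (Or.inl h1)

/-! ## The conflict step with prepared successors -/

open scoped Classical in
/-- **THE CONFLICT STEP, PREPARED SUCCESSORS.**  Let `b` represent the positive label `A` with boundary `N`, and let `A` carry a permissible graph
branch with datum `λ + u₁h₁` (`h₁` `u₂`-free), re-centring `ψ` (`ψ(0) = 0`).  The point blow-up is a legal count move all of whose successors are
unit × monomial, or represent the PREPARED translated chart `blowOneT d (prep d (shearT (C c) A))` with boundary `{u₁} ∪ {u₂ : u₂ ∈ N, c = 0}` —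
at `c = λ` carrying a permissible graph branch with datum `h₁` —, or represent `blowTwoT d A` with boundary `{u₂} ∪ {u₁ : u₁ ∈ N}`.  All these
labels are well-prepared (`wellPrepared_pointSucc_prep/_two`), hence regime labels or exits. -/
theorem conflict_pointMove_prep (hd : 0 < d) {A : Fin d → MvPowerSeries (Fin 2) k} (hpos : IsPosT d A) {b : MvPowerSeries (Fin 3) k}
    {N : Finset (Fin 2)} (hrep : NCPoly.Represents b d A N) (la : k) (h₁ ψ : MvPowerSeries (Fin 2) k)
    (hh₁ : ∀ e : Fin 2 →₀ ℕ, e 1 ≠ 0 → coeff e h₁ = 0) (hψ : constantCoeff ψ = 0)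
    (hperm : IsPermissibleTwoT d (shift d (shearT (C la + X 0 * h₁) A) ψ)) :
    ∃ Φ : Fin 3 → MvPowerSeries (Fin 3) k, IsCountMove (m := 2) Φ (fun _ => 1) ∧
      MoveClause (m := 2) b Φ (fun _ => 1) (fun b' => NCPoly.IsStdNC b' ∨
        (∃ c : k, NCPoly.Represents b' d (blowOneT d (prep d (shearT (C c) A))) (insert 0 (N.filter fun l => l = 1 ∧ c = 0)) ∧
          (c = la → ∃ ψ' : MvPowerSeries (Fin 2) k, constantCoeff ψ' = 0 ∧
            IsPermissibleTwoT d (shift d (shearT h₁ (blowOneT d (prep d (shearT (C c) A)))) ψ'))) ∨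
        NCPoly.Represents b' d (blowTwoT d A) (insert 1 (N.filter fun l => l = 0))) := by
  obtain ⟨Φ, hmv, hcl⟩ := conflict_pointMove hd hpos hrep la h₁ ψ hh₁ hψ hperm
  refine ⟨Φ, hmv, hcl.mono fun b' hb' => hb'.imp_right fun h => h.imp_left ?_⟩
  rintro ⟨c, hrep', -⟩
  -- re-prepare the translated chart for free
  set Y := shearT (C c) A with hY
  have hposY : IsPosT d Y := isPosT_shearT _ hpos
  obtain ⟨hχ0, hposB, -, -⟩ := isPrepRecentring_prepPsi (stub_polyPrep k d hd Y hposY)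
  have hχ1 : (1 : ℕ∞) ≤ (prepPsi d Y).order := one_le_order_iff_constCoeff_eq_zero.mpr hχ0
  have hcomm := blowOneT_shift Y (prepPsi d Y) (fun j => (hposY j).le) hχ1
  have hchi1 : constantCoeff (blowOne 1 (prepPsi d Y)) = 0 := by
    rw [constantCoeff_blowOne_one_eq]
    exact coeff_single_one_eq_zero_of_isPosT_shift hd hposY hχ0 hposB 0
  refine ⟨c, ?_, ?_⟩
  · rw [PolyDescent.prep, hcomm]
    exact hrep'.shift hchi1
  · rintro rfl
    exact graph_blowOneT_translate hd A c h₁ ψ (prepPsi d Y) hh₁ hψ hχ0 hposB hperm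

open scoped Classical in
/-- The same from a graph datum `(h, ψ)` as in `HasGraphCurveT`: at `c = h(0)` the prepared successor has a graph curve. -/
theorem conflict_pointMove_prep' (hd : 0 < d) {A : Fin d → MvPowerSeries (Fin 2) k} (hpos : IsPosT d A) {b : MvPowerSeries (Fin 3) k}
    {N : Finset (Fin 2)} (hrep : NCPoly.Represents b d A N) (h ψ : MvPowerSeries (Fin 2) k)
    (hh : ∀ e : Fin 2 →₀ ℕ, e 1 ≠ 0 → coeff e h = 0) (hψ : constantCoeff ψ = 0) (hperm : IsPermissibleTwoT d (shift d (shearT h A) ψ)) :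
    ∃ Φ : Fin 3 → MvPowerSeries (Fin 3) k, IsCountMove (m := 2) Φ (fun _ => 1) ∧
      MoveClause (m := 2) b Φ (fun _ => 1) (fun b' => NCPoly.IsStdNC b' ∨
        (∃ c : k, NCPoly.Represents b' d (blowOneT d (prep d (shearT (C c) A))) (insert 0 (N.filter fun l => l = 1 ∧ c = 0)) ∧
          (c = constantCoeff h → HasGraphCurveT d (blowOneT d (prep d (shearT (C c) A))))) ∨
        NCPoly.Represents b' d (blowTwoT d A) (insert 1 (N.filter fun l => l = 0))) := by
  obtain ⟨h₁, hh₁, hsplit⟩ := exists_eq_C_add_X_mul_of_noY h hh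
  rw [hsplit] at hperm
  obtain ⟨Φ, hmv, hcl⟩ := conflict_pointMove_prep hd hpos hrep (constantCoeff h) h₁ ψ hh₁ hψ hperm
  refine ⟨Φ, hmv, hcl.mono fun b' hb' => hb'.imp_right fun hb'' => hb''.imp_left ?_⟩
  rintro ⟨c, hrep', hgraph⟩
  refine ⟨c, hrep', fun hc => ?_⟩
  obtain ⟨ψ', hψ', hperm'⟩ := hgraph hc
  exact ⟨h₁, ψ', hh₁, hψ', hperm'⟩

end TOT2Curve

end Summit.ResolutionOfSingularities.ResolutionOfSingularities.Theorems

end
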